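import Summits.QuantumFields.YangMills.Theorems.UnitScaleTiltHalvingP1FlatPillarWrapWitness
import Summits.QuantumFields.YangMills.Theorems.UnitScaleTiltHalvingP1FlatPillarPrime
import HarnessLib

/-!
# Route `UnitScaleTilt`, crux K1 child «MinimiserStabilityRegPr» (stmt-QuantumFields-19200), registered stub `stub_halvingStep` (H) —
# HAZARD «hP1-HOLONOMY» (★★OWNER RULING g26-№27), STAGE 2: **THE H-DOOR'S BINDER `hP1` IS UNINHABITABLE** — `¬ P1FlatPillar 3 ρ …` and `¬ P1FlatPillar′ 3 ρ …` for
# every `ρ ≥ 3`, and `hP1_false` (the hypothesis of ✓`HalvingStepOfPillars.halvingStep_of_rows` :113–116, VERBATIM, negated)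

WHY.  The pillar texts `P1FlatPillar L ρ S M …` (✓p619487 :126–130) and `P1FlatPillar′` (✓p625022) quantify over EVERY member `F` with `F.L = L` and every `n < K`, and ask a
BACKGROUND-`1` chart `u(z)⁻¹·U⟨z,μ⟩·u(z+e_μ) = exp(iηA⟨z,μ⟩)` with `‖A‖ ≤ B₁ε₀` on the member's positive-level layers ((ii)∕(iii)) resp. on `□₀` ((ii′)).  At a member whose
TOP CUBE WRAPS A TORUS CYCLE (`sitesPerDir (K−n) ≤ 2ρ + 1`; here `L = 3`, `m = 1`, `n = 0`, `K = 1`: top torus `6` sites per direction, fine torus `18`) the chart sits on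
every fine bond (stage 1, §4), and the 't Hooft sheet of the trivial configuration (stage 1, §§1–3: flat, in `RegPr` at every `ε₀`, its descent flat, `U ∈ fibre (D U)` by `rfl`)
is an ADMISSIBLE datum whose straight 18-cycle carries the CENTRAL holonomy `−1`.  Multiplying the chart identities along the cycle (`prod_telescope`) gives
`∏ᵢ exp(iηAᵢ) = u(x₀)⁻¹·(−1)·u(x₀) = −1` in `M₂(ℂ)ˣ`, whereas `‖∏ᵢ exp(iηAᵢ) − 1‖ ≤ (e^{B₁ε₀∕3})^{18} − 1 ≤ e − 1 < 2 = ‖−1 − 1‖` once `6B₁ε₀ ≤ 1` — and the pillar lets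
`ε₀` be as small as we please.

WHAT IS PROVED (0 sorry):
* `mem_cubeSetM_zero_of_wrap` — on a member whose fine torus fits in `□₀`, every fine site lies in `cubeSetM x (K−n) ρ S M 0`;
* `chart_all_bonds_of_pillarAt`, `chart_all_bonds_of_pillarAt'` — on a wrapping member, `P1FlatPillarAt(′)` puts the chart on EVERY fine bond with `‖A‖ ≤ B₁ε₀`;
* ★`false_of_chart_along_cycle` — the core contradiction along the sheet's cycle (`L = 3`, 18 fine sites, `6B₁ε₀ ≤ 1`);
* ★★`not_p1FlatPillar_three`, ★★`not_p1FlatPillar'_three` — `¬ P1FlatPillar(′) 3 ρ S M hM a Cr B₁ C₁ C₂` for all `ρ ≥ 3`, `M ≥ 1`, `a, Cr > 0`, `B₁ ≥ 0`, any `S, C₁, C₂`;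
* ★★★`hP1_false` — the door's second binder is FALSE (at `L = 3`, `M = 1`, its own `B₁`, `ρ := 3`, `a := (16·3800·15²·3·(B₁+1))⁻¹`, `Cr := 48a`).

CONSEQUENCES (RULING №27, for the record; nothing registered is refuted): the door ✓p623036 is vacuously sound; every P1-type text filed from now on carries the «room» binder (R-a)
(top cube + collar do not wrap); the H stub at the wrapping classes is the named residual «H-SMALL» with route (R-b) = [B8] Thm 2 at a FLAT BACKGROUND `U₀ ≠ 1`.  The registered
stub `BirthV10.stub_halvingStep` is untouched in truth value: its conclusion `InU` is gauge-invariant and holds trivially at the sheet.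

Cell `ym3-torus` (HUMAN RULING D-0037, YM ladder rung R3 — continuum SU(2) YM₃ on the torus is a RUNG, not the Clay problem, not `d = 4`, not a gap), width seat
`ym-ust-20520-w1` gen 6; `--supports stmt-QuantumFields-19200 --as helper`; def-free, 0 sorry, standard axioms.

References: T. Bałaban, CMP **102** (1985) [Balaban1985Variational] (144) p.300, (150)–(152) p.301, (152)–(168) pp.301–304; CMP **99** (1985) [Balaban1985RegularSpaces]
Thm 2 p.83, (1.36)–(1.37) p.82; G. 't Hooft, Nucl. Phys. B **153** (1979) [tHooft1979Flux] §2; CMP **109** (1987) [Balaban1987RG1] (0.1) p.251.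
-/

set_option autoImplicit false

noncomputable section

open scoped BigOperators Matrix.Norms.L2Operator

namespace Summit.QuantumFields.YangMills.Theorems.HalvingP1FlatPillarWrapWitness

open Literature.MathematicalPhysics.QuantumFieldTheory.Balaban1983to89
open Literature.MathematicalPhysics.QuantumFieldTheory.Balaban1983to89.T3ContinuumYM3Torus
open Literature.MathematicalPhysics.QuantumFieldTheory.Balaban1983to89.T3PrintedRegularMinimiser
open Literature.MathematicalPhysics.QuantumFieldTheory.Balaban1983to89.T3RegularMinimiser
open Literature.MathematicalPhysics.QuantumFieldTheory.Balaban1983to89.T3ConstrainedMinimiser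
open Literature.MathematicalPhysics.QuantumFieldTheory.Balaban1983to89.T3TiltDescent
open Literature.MathematicalPhysics.QuantumFieldTheory.Balaban1983to89.T3UnitLawDensityEML (ℰp)
open B10Eq27TorusAxialLog (transl transl_apply unitsField toUField transl_add_e val_unitsField val_suIncl)
open B7Prop1Explicit (e e_apply expUnit)

/-! ## §6 (stage 2) No background-`1` chart on a wrapping member -/

section Negative

open FlatCubeSequenceAligned (cubeSeqMT3 cubeSetM cubeFinM radM radM_succ mem_cubeFinM_of_dist)
open FlatCubeOpsText (IsLevWeight)
open B5Eq117TorusCarriers (Mk)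
open B5Eq118OneStroke (iterBlockOf)
open B5Prop12FieldsLattice (distSite)
open B11Eq115Space (levOf)
open HalvingP1FlatPillar (P1FlatPillar P1FlatPillarAt)
open HalvingP1FlatPillarPrime (P1FlatPillar' P1FlatPillarAt' mem_cubeSetM_zero_iff)
open Complex (I)

/-- **WRAPPING AT LEVEL 0**: if the fine torus fits in the level-0 cube (`sitesPerDir 0 ∕ 2 ≤ radM L M ρ S (K−n)`), every fine site lies in `□₀ = cubeSetM x (K−n) ρ S M 0`
of the aligned sequence of ANY centre `x` — so (ii′) of `P1FlatPillarAt′` is asked on every fine bond. [cite: Balaban1985Variational, (144) p.300, (150) p.301] -/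
theorem mem_cubeSetM_zero_of_wrap (F : T3Family) (n K : ℕ) (x : Site (F.P K) 0) {ρ S M : ℕ}
    (hwrap0 : (F.P K).sitesPerDir 0 / 2 ≤ radM (F.P K).L M ρ S (K - n)) (y : Site (F.P K) 0) :
    y ∈ cubeSetM x (K - n) ρ S M 0 := by
  rw [mem_cubeSetM_zero_iff]
  refine mem_cubeFinM_of_dist x (K - n) ρ S M 0 ((distSite_le_half 0 y _).trans ?_)
  rw [Nat.sub_zero]
  exact_mod_cast hwrap0

/-- **ON A WRAPPING MEMBER THE PILLAR'S CHART SITS ON EVERY FINE BOND WITH `‖A‖ ≤ B₁ε₀`**: (iii) at the canonical level weights (all equal to `1`, `levWeight_one_of_wrap`) and (ii) at the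
top layer, which every bond side-touches (`sideTouches_top_of_wrap`). [cite: Balaban1985Variational, (152) p.301; Balaban1985RegularSpaces, Thm 2 (1.36)-(1.37) p.82] -/
theorem chart_all_bonds_of_pillarAt (F : T3Family) (n K : ℕ) (hnK : n < K) {ρ S M : ℕ} (hM : 1 ≤ M) (hwrap : (F.P K).sitesPerDir (K - n) / 2 ≤ ρ)
    (x : Site (F.P K) 0) {ε₀ ε₁ B₁ C₁ C₂ : ℝ} {U : GaugeField (F.P K) 0 (Matrix.specialUnitaryGroup (Fin 2) ℂ)}
    (h : P1FlatPillarAt F n K (cubeSeqMT3 F n K x ρ S M hM) x ε₀ ε₁ B₁ C₁ C₂ U) :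
    ∃ (u : GaugeTransf (F.P K) 0 (Matrix.unitaryGroup (Fin 2) ℂ)) (A : PBond (F.P K) 0 → Matrix (Fin 2) (Fin 2) ℂ),
      (∀ b : PBond (F.P K) 0, ‖A b‖ ≤ B₁ * ε₀) ∧
      ∀ (z : B7Prop1Explicit.Site (F.P K).d) (μ : Fin (F.P K).d),
        (Unitary.toUnits (u (transl 0 z)))⁻¹ * unitsField (toUField U) ⟨transl 0 z, μ⟩ * Unitary.toUnits (u ((transl 0 z).shift μ)) =
          expUnit (I • ((((F.L : ℝ)⁻¹) ^ (K - n)) • A ⟨transl 0 z, μ⟩)) := by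
  obtain ⟨u, A, -, -, -, hii, hiii, -, -, -⟩ := h
  refine ⟨u, A, fun b => ?_, fun z μ => hii (K - n) (by omega) le_rfl z μ (sideTouches_top_of_wrap F n K hnK hwrap x S M hM z μ)⟩
  have hw : IsLevWeight F n K (cubeSeqMT3 F n K x ρ S M hM) (fun m b =>
      ((F.L : ℝ) ^ levOf (fun j => {y : Site (F.P K) 0 | (cubeSeqMT3 F n K x ρ S M hM).InOm j y}) (K - n) b.src * ((F.L : ℝ)⁻¹) ^ (K - n)) ^ m) :=
    fun m b => rfl
  have hb := (hiii _ hw).1 b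
  rwa [levWeight_one_of_wrap F n K hnK hwrap x S M hM hw, one_mul] at hb

/-- The same for the PRIMED text `P1FlatPillarAt′` ((ii′) on `Ω₀ := □₀`), when moreover the fine torus fits in `□₀` (`mem_cubeSetM_zero_of_wrap`).
[cite: Balaban1985Variational, (150)-(152) p.301; Balaban1985RegularSpaces, Thm 2 (1.36)-(1.37) p.82] -/
theorem chart_all_bonds_of_pillarAt' (F : T3Family) (n K : ℕ) (hnK : n < K) {ρ S M : ℕ} (hM : 1 ≤ M) (hwrap : (F.P K).sitesPerDir (K - n) / 2 ≤ ρ)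
    (hwrap0 : (F.P K).sitesPerDir 0 / 2 ≤ radM (F.P K).L M ρ S (K - n))
    (x : Site (F.P K) 0) {ε₀ ε₁ B₁ C₁ C₂ : ℝ} {U : GaugeField (F.P K) 0 (Matrix.specialUnitaryGroup (Fin 2) ℂ)}
    (h : P1FlatPillarAt' F n K (cubeSeqMT3 F n K x ρ S M hM) (cubeSetM x (K - n) ρ S M 0) x ε₀ ε₁ B₁ C₁ C₂ U) :
    ∃ (u : GaugeTransf (F.P K) 0 (Matrix.unitaryGroup (Fin 2) ℂ)) (A : PBond (F.P K) 0 → Matrix (Fin 2) (Fin 2) ℂ),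
      (∀ b : PBond (F.P K) 0, ‖A b‖ ≤ B₁ * ε₀) ∧
      ∀ (z : B7Prop1Explicit.Site (F.P K).d) (μ : Fin (F.P K).d),
        (Unitary.toUnits (u (transl 0 z)))⁻¹ * unitsField (toUField U) ⟨transl 0 z, μ⟩ * Unitary.toUnits (u ((transl 0 z).shift μ)) =
          expUnit (I • ((((F.L : ℝ)⁻¹) ^ (K - n)) • A ⟨transl 0 z, μ⟩)) := by
  obtain ⟨u, A, -, -, -, hii, hiii, -, -, -⟩ := h
  refine ⟨u, A, fun b => ?_, fun z μ =>
    hii z μ (mem_cubeSetM_zero_of_wrap F n K x hwrap0 _) (mem_cubeSetM_zero_of_wrap F n K x hwrap0 _)⟩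
  have hw : IsLevWeight F n K (cubeSeqMT3 F n K x ρ S M hM) (fun m b =>
      ((F.L : ℝ) ^ levOf (fun j => {y : Site (F.P K) 0 | (cubeSeqMT3 F n K x ρ S M hM).InOm j y}) (K - n) b.src * ((F.L : ℝ)⁻¹) ^ (K - n)) ^ m) :=
    fun m b => rfl
  have hb := (hiii _ hw).1 b
  rwa [levWeight_one_of_wrap F n K hnK hwrap x S M hM hw, one_mul] at hb

/-- **CORE: NO SMALL BACKGROUND-`1` CHART ALONG THE SHEET'S CYCLE.**  On a member with `L = 3` and `18` fine sites per direction, if a `U(2)` gauge map `u` and a one-form `A`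
with `‖A‖ ≤ B₁ε₀` satisfy the chart identity `u(x)⁻¹·U⟨x,μ⟩·u(x+e_μ) = exp(iηA⟨x,μ⟩)` (`η = L^{−(1−0)} = 1∕3`) on the `18` bonds of the straight `μ`-cycle through the sheet of
the trivial configuration, and `6B₁ε₀ ≤ 1`, then `False`: telescoping gives `∏ᵢ exp(iηAᵢ) = u(x₀)⁻¹·(−1)·u(x₀) = −1`, so `2 = ‖−1 − 1‖ ≤ (e^{B₁ε₀∕3})^{18} − 1 ≤ e − 1 < 2`.
[cite: tHooft1979Flux, §2; Balaban1985RegularSpaces, Thm 2 (1.36) p.82; Balaban1985Variational, (152) p.301] -/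
theorem false_of_chart_along_cycle (F : T3Family) (hL : F.L = 3) (hN : (F.P 1).sitesPerDir 0 = 18) (μ : Fin (F.P 1).d)
    (s₀ : ZMod ((F.P 1).sitesPerDir 0)) (u : GaugeTransf (F.P 1) 0 (Matrix.unitaryGroup (Fin 2) ℂ)) (A : PBond (F.P 1) 0 → Matrix (Fin 2) (Fin 2) ℂ)
    {B₁ ε₀ : ℝ} (hB₁ : 0 ≤ B₁) (hε₀ : 0 ≤ ε₀) (hε₀B : 6 * B₁ * ε₀ ≤ 1) (hA : ∀ b : PBond (F.P 1) 0, ‖A b‖ ≤ B₁ * ε₀)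
    (hii : ∀ (z : B7Prop1Explicit.Site (F.P 1).d),
      (Unitary.toUnits (u (transl 0 z)))⁻¹ *
          unitsField (toUField ((1 : GaugeField (F.P 1) 0 (Matrix.specialUnitaryGroup (Fin 2) ℂ)).ctwist negOne₂ μ s₀)) ⟨transl 0 z, μ⟩ *
          Unitary.toUnits (u ((transl 0 z).shift μ)) =
        expUnit (I • ((((F.L : ℝ)⁻¹) ^ (1 - 0)) • A ⟨transl 0 z, μ⟩))) : False := by
  -- the three families along the cycle: gauge values `gᵢ`, bond variables `Wᵢ`, chart exponentials `Eᵢ`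
  set g : ℕ → (Matrix (Fin 2) (Fin 2) ℂ)ˣ :=
    fun i => Unitary.toUnits (u (transl (0 : Site (F.P 1) 0) (((s₀.val : ℤ) + (i : ℤ)) • e μ))) with hgdef
  set W : ℕ → (Matrix (Fin 2) (Fin 2) ℂ)ˣ := fun i =>
    unitsField (toUField ((1 : GaugeField (F.P 1) 0 (Matrix.specialUnitaryGroup (Fin 2) ℂ)).ctwist negOne₂ μ s₀))
      ⟨transl (0 : Site (F.P 1) 0) (((s₀.val : ℤ) + (i : ℤ)) • e μ), μ⟩ with hWdef
  set E : ℕ → (Matrix (Fin 2) (Fin 2) ℂ)ˣ :=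
    fun i => expUnit (I • ((((F.L : ℝ)⁻¹) ^ (1 - 0)) • A ⟨transl (0 : Site (F.P 1) 0) (((s₀.val : ℤ) + (i : ℤ)) • e μ), μ⟩)) with hEdef
  have hstep : ∀ i : ℕ, i < (F.P 1).sitesPerDir 0 → (g i)⁻¹ * W i * g (i + 1) = E i := by
    intro i _
    show (Unitary.toUnits (u (transl (0 : Site (F.P 1) 0) (((s₀.val : ℤ) + (i : ℤ)) • e μ))))⁻¹ *
          unitsField (toUField ((1 : GaugeField (F.P 1) 0 (Matrix.specialUnitaryGroup (Fin 2) ℂ)).ctwist negOne₂ μ s₀))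
            ⟨transl (0 : Site (F.P 1) 0) (((s₀.val : ℤ) + (i : ℤ)) • e μ), μ⟩ *
          Unitary.toUnits (u (transl (0 : Site (F.P 1) 0) (((s₀.val : ℤ) + ((i + 1 : ℕ) : ℤ)) • e μ))) =
        expUnit (I • ((((F.L : ℝ)⁻¹) ^ (1 - 0)) • A ⟨transl (0 : Site (F.P 1) 0) (((s₀.val : ℤ) + (i : ℤ)) • e μ), μ⟩))
    rw [transl_cycle_succ]
    exact hii _
  have htel := prod_telescope g W E ((F.P 1).sitesPerDir 0) hstep
  -- the bond product is the twisted bond, whose value is the central `−1`; the cycle closes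
  have hW1 : ∀ i, 0 < i → i < (F.P 1).sitesPerDir 0 → W i = 1 := fun i hi hiN => unitsField_cycle_pos μ s₀ hi hiN
  have hW0 : ((W 0 : (Matrix (Fin 2) (Fin 2) ℂ)ˣ) : Matrix (Fin 2) (Fin 2) ℂ) = -1 := by
    have h := val_unitsField_cycle_zero μ s₀
    rwa [Nat.cast_zero] at h
  have hgN : g ((F.P 1).sitesPerDir 0) = g 0 := by
    show Unitary.toUnits (u (transl (0 : Site (F.P 1) 0) (((s₀.val : ℤ) + (((F.P 1).sitesPerDir 0 : ℕ) : ℤ)) • e μ))) =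
      Unitary.toUnits (u (transl (0 : Site (F.P 1) 0) (((s₀.val : ℤ) + ((0 : ℕ) : ℤ)) • e μ)))
    rw [transl_cycle_period μ s₀]
  rw [prod_range_map_eq_head W (by rw [hN]; norm_num) hW1, hgN] at htel
  have hval : ((((List.range ((F.P 1).sitesPerDir 0)).map E).prod : (Matrix (Fin 2) (Fin 2) ℂ)ˣ) : Matrix (Fin 2) (Fin 2) ℂ) = -1 := by
    rw [← htel, Units.val_mul, Units.val_mul, hW0, mul_neg_one, neg_mul, Units.inv_mul]
  -- the estimate on each chart exponential
  have hη : ((F.L : ℝ)⁻¹) ^ (1 - 0) = (3 : ℝ)⁻¹ := by rw [hL]; norm_num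
  set t : ℝ := Real.exp (B₁ * ε₀ / 3) - 1 with htdef
  have ht : 0 ≤ t := by rw [htdef]; linarith [Real.add_one_le_exp (B₁ * ε₀ / 3), mul_nonneg hB₁ hε₀]
  have hfac : ∀ X ∈ (List.range ((F.P 1).sitesPerDir 0)).map (fun i => ((E i : (Matrix (Fin 2) (Fin 2) ℂ)ˣ) : Matrix (Fin 2) (Fin 2) ℂ)),
      ‖X - 1‖ ≤ t := by
    intro X hX
    rw [List.mem_map] at hX
    obtain ⟨i, -, rfl⟩ := hX
    show ‖((expUnit (I • ((((F.L : ℝ)⁻¹) ^ (1 - 0)) • A ⟨transl (0 : Site (F.P 1) 0) (((s₀.val : ℤ) + (i : ℤ)) • e μ), μ⟩)) :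
        (Matrix (Fin 2) (Fin 2) ℂ)ˣ) : Matrix (Fin 2) (Fin 2) ℂ) - 1‖ ≤ t
    rw [B7Prop1Explicit.val_expUnit]
    refine (B7Prop1Explicit.norm_exp_sub_one_le_of_norm_le ?_).1
    rw [norm_smul, Complex.norm_I, one_mul, hη, norm_smul, norm_inv, Real.norm_ofNat]
    have := hA ⟨transl (0 : Site (F.P 1) 0) (((s₀.val : ℤ) + (i : ℤ)) • e μ), μ⟩
    rw [inv_mul_le_iff₀ (by norm_num : (0:ℝ) < 3)]
    linarith
  have hcoe : ((List.range ((F.P 1).sitesPerDir 0)).map (fun i => ((E i : (Matrix (Fin 2) (Fin 2) ℂ)ˣ) : Matrix (Fin 2) (Fin 2) ℂ))).prod =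
      ((((List.range ((F.P 1).sitesPerDir 0)).map E).prod : (Matrix (Fin 2) (Fin 2) ℂ)ˣ) : Matrix (Fin 2) (Fin 2) ℂ) := by
    rw [← Units.coeHom_apply, map_list_prod, List.map_map]
    rfl
  -- `‖−1 − 1‖ = 2`, but `(1+t)^18 − 1 = e^{6B₁ε₀} − 1 ≤ e − 1 < 2`
  have h2 : ‖(-1 : Matrix (Fin 2) (Fin 2) ℂ) - 1‖ = 2 := by
    rw [show (-1 : Matrix (Fin 2) (Fin 2) ℂ) - 1 = -((2 : ℝ) • (1 : Matrix (Fin 2) (Fin 2) ℂ)) by rw [two_smul]; abel,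
      norm_neg, norm_smul, norm_one, mul_one, Real.norm_ofNat]
  have hprod := norm_list_prod_sub_one_le ht _ hfac
  rw [List.length_map, List.length_range, hcoe, hval, hN, h2] at hprod
  have h18 : (1 + t) ^ (18 : ℕ) - 1 ≤ Real.exp 1 - 1 := by
    rw [htdef, add_sub_cancel, ← Real.exp_nat_mul]
    gcongr
    push_cast
    nlinarith [mul_nonneg hB₁ hε₀]
  have he := Real.exp_one_lt_d9
  linarith

/-- **THE PILLAR TEXT `P1FlatPillar 3 ρ S M …` IS FALSE FOR EVERY `ρ ≥ 3`** (member `m = 1`, `n = 0`, `K = 1`: the top torus has `6` sites per direction and is covered by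
the top cube; the sheet datum of stage 1 is admissible at `ε₀ := min a (6(B₁+1))⁻¹`, `ε₁ := ε₀∕Cr`).
[cite: Balaban1985Variational, (144) p.300, (152) p.301; Balaban1985RegularSpaces, Thm 2 p.83; tHooft1979Flux, §2] -/
theorem not_p1FlatPillar_three {ρ S M : ℕ} (hM : 1 ≤ M) (hρ : 3 ≤ ρ) {a Cr B₁ C₁ C₂ : ℝ} (ha : 0 < a) (hCr : 0 < Cr) (hB₁ : 0 ≤ B₁) :
    ¬ P1FlatPillar 3 ρ S M hM a Cr B₁ C₁ C₂ := by
  intro hP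
  let F : T3Family := ⟨3, ⟨by decide, by norm_num⟩, 1, le_rfl⟩
  have hN : (F.P 1).sitesPerDir 0 = 18 := by show 2 * 3 ^ (1 + 1 - 0) = 18; norm_num
  have hwrap : (F.P 1).sitesPerDir (1 - 0) / 2 ≤ ρ := by show 2 * 3 ^ (1 + 1 - (1 - 0)) / 2 ≤ ρ; norm_num; omega
  let μ : Fin (F.P 1).d := ⟨0, by rw [T3Family.P_d]; norm_num⟩
  obtain ⟨s₀, hs₀⟩ := exists_plaqSmall_descendTo_ctwist_one F 0 1 zero_le_one μ
  -- the regime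
  set ε₀ : ℝ := min a (1 / (6 * (B₁ + 1))) with hε₀def
  have hε₀ : 0 < ε₀ := lt_min ha (by positivity)
  have hε₀B : 6 * B₁ * ε₀ ≤ 1 := by
    have h1 : ε₀ ≤ 1 / (6 * (B₁ + 1)) := min_le_right _ _
    have h2 : 6 * B₁ * ε₀ ≤ 6 * B₁ * (1 / (6 * (B₁ + 1))) := by gcongr
    have h3 : 6 * B₁ * (1 / (6 * (B₁ + 1))) ≤ 1 := by
      rw [mul_one_div, div_le_one (by positivity)]; linarith
    linarith
  have hε₁ : 0 < ε₀ / Cr := div_pos hε₀ hCr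
  -- the datum, the chart, the contradiction
  have hreg := regPr_ctwist_one F 0 1 hε₀ μ s₀
  obtain ⟨u, A, hA, hii⟩ := chart_all_bonds_of_pillarAt F 0 1 zero_lt_one hM hwrap 0
    (hP F rfl 0 1 zero_lt_one ε₀ (ε₀ / Cr) hε₁ hε₀ (min_le_left _ _) (by rw [mul_div_cancel₀ _ hCr.ne']) _ (hs₀ _ hε₁)
      ((1 : GaugeField (F.P 1) 0 (Matrix.specialUnitaryGroup (Fin 2) ℂ)).ctwist negOne₂ μ s₀) ⟨⟨rfl, hreg.1⟩, hreg.2⟩ 0)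
  exact false_of_chart_along_cycle F rfl hN μ s₀ u A hB₁ hε₀.le hε₀B hA (fun z => hii z μ)

/-- **THE PRIMED PILLAR TEXT `P1FlatPillar′ 3 ρ S M …` (J5's target; (ii′) on the level-0 cube `□₀`) IS FALSE FOR EVERY `ρ ≥ 3`** — same member, same datum: `□₀` (radius
`radM(1) = 3ρ + 3M − 1 + S ≥ 9`) is the whole fine torus. [cite: Balaban1985Variational, (144) p.300, (150)-(152) p.301; tHooft1979Flux, §2] -/
theorem not_p1FlatPillar'_three {ρ S M : ℕ} (hM : 1 ≤ M) (hρ : 3 ≤ ρ) {a Cr B₁ C₁ C₂ : ℝ} (ha : 0 < a) (hCr : 0 < Cr) (hB₁ : 0 ≤ B₁) :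
    ¬ P1FlatPillar' 3 ρ S M hM a Cr B₁ C₁ C₂ := by
  intro hP
  let F : T3Family := ⟨3, ⟨by decide, by norm_num⟩, 1, le_rfl⟩
  have hN : (F.P 1).sitesPerDir 0 = 18 := by show 2 * 3 ^ (1 + 1 - 0) = 18; norm_num
  have hwrap : (F.P 1).sitesPerDir (1 - 0) / 2 ≤ ρ := by show 2 * 3 ^ (1 + 1 - (1 - 0)) / 2 ≤ ρ; norm_num; omega
  have hwrap0 : (F.P 1).sitesPerDir 0 / 2 ≤ radM (F.P 1).L M ρ S (1 - 0) := by
    show 2 * 3 ^ (1 + 1 - 0) / 2 ≤ radM 3 M ρ S (0 + 1)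
    rw [radM_succ, show radM 3 M ρ S 0 = ρ from rfl]; norm_num; omega
  let μ : Fin (F.P 1).d := ⟨0, by rw [T3Family.P_d]; norm_num⟩
  obtain ⟨s₀, hs₀⟩ := exists_plaqSmall_descendTo_ctwist_one F 0 1 zero_le_one μ
  set ε₀ : ℝ := min a (1 / (6 * (B₁ + 1))) with hε₀def
  have hε₀ : 0 < ε₀ := lt_min ha (by positivity)
  have hε₀B : 6 * B₁ * ε₀ ≤ 1 := by
    have h1 : ε₀ ≤ 1 / (6 * (B₁ + 1)) := min_le_right _ _
    have h2 : 6 * B₁ * ε₀ ≤ 6 * B₁ * (1 / (6 * (B₁ + 1))) := by gcongr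
    have h3 : 6 * B₁ * (1 / (6 * (B₁ + 1))) ≤ 1 := by
      rw [mul_one_div, div_le_one (by positivity)]; linarith
    linarith
  have hε₁ : 0 < ε₀ / Cr := div_pos hε₀ hCr
  have hreg := regPr_ctwist_one F 0 1 hε₀ μ s₀
  obtain ⟨u, A, hA, hii⟩ := @chart_all_bonds_of_pillarAt' F 0 1 zero_lt_one ρ S M hM hwrap hwrap0 0 _ _ _ _ _ _
    (hP F rfl 0 1 zero_lt_one ε₀ (ε₀ / Cr) hε₁ hε₀ (min_le_left _ _) (by rw [mul_div_cancel₀ _ hCr.ne']) _ (hs₀ _ hε₁)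
      ((1 : GaugeField (F.P 1) 0 (Matrix.specialUnitaryGroup (Fin 2) ℂ)).ctwist negOne₂ μ s₀) ⟨⟨rfl, hreg.1⟩, hreg.2⟩ 0)
  exact false_of_chart_along_cycle F rfl hN μ s₀ u A hB₁ hε₀.le hε₀B hA (fun z => hii z μ)

/-- ★★★ **THE H-DOOR'S SECOND BINDER IS UNINHABITABLE**: the hypothesis `hP1` of ✓`HalvingStepOfPillars.halvingStep_of_rows` (:113–116), VERBATIM, is FALSE — at `L = 3`, `M = 1`,
any `S`, for the `B₁` it offers, the radius `ρ := 3` and `a := (16·3800·15²·3·(B₁+1))⁻¹`, `Cr := 48a` meet its three premises, and `not_p1FlatPillar_three` denies the conclusion.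
(HAZARD «hP1-HOLONOMY», ★★OWNER RULING g26-№27: the door is vacuously sound; repair = the «room» binder (R-a) + the residual «H-SMALL» (R-b).)
[cite: Balaban1985Variational, (144) p.300, (152)-(168) pp.301-304; Balaban1985RegularSpaces, Thm 2 p.83; tHooft1979Flux, §2] -/
theorem hP1_false :
    ¬ (∀ L : ℕ, Odd L → 1 < L → ∀ (S M : ℕ) (hM : 1 ≤ M), ∃ B₁ : ℝ, 0 ≤ B₁ ∧
      ∀ (ρ : ℕ) (a Cr : ℝ), 0 < Cr → 12 * ((ρ : ℝ) + (M : ℝ)) * a ≤ Cr →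
        16 * 3800 * ((5 * L : ℕ) : ℝ) ^ 2 * (L : ℝ) * ((B₁ + 1) * a) ≤ 1 → P1FlatPillar L ρ S M hM a Cr B₁ 6 (8 * (L : ℝ) * (B₁ + 1))) := by
  intro h
  obtain ⟨B₁, hB₁, hρ⟩ := h 3 (by decide) (by norm_num) 0 1 le_rfl
  set X : ℝ := 16 * 3800 * ((5 * 3 : ℕ) : ℝ) ^ 2 * ((3 : ℕ) : ℝ) * (B₁ + 1) with hXdef
  have hX : 0 < X := by positivity
  have ha : 0 < X⁻¹ := inv_pos.2 hX
  refine not_p1FlatPillar_three le_rfl le_rfl ha (Cr := 12 * (((3 : ℕ) : ℝ) + ((1 : ℕ) : ℝ)) * X⁻¹) (by positivity) hB₁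
    (hρ 3 X⁻¹ _ (by positivity) le_rfl (le_of_eq ?_))
  rw [show 16 * 3800 * ((5 * 3 : ℕ) : ℝ) ^ 2 * ((3 : ℕ) : ℝ) * ((B₁ + 1) * X⁻¹) = X * X⁻¹ by rw [hXdef]; ring, mul_inv_cancel₀ hX.ne']

end Negative

end Summit.QuantumFields.YangMills.Theorems.HalvingP1FlatPillarWrapWitness

end
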